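import Mathlib
import HarnessLib
import Summits.ValiantsHypothesis.ValiantsHypothesis.Theorems.LacunarySymmetroidMatrixDescartesOsculationLawStubRankOne
import Summits.ValiantsHypothesis.ValiantsHypothesis.Theorems.LacunarySymmetroidMatrixDescartesOsculationLawTwoKPencil

/-!
# ValiantsHypothesis / LacunarySymmetroid — crux `MatrixDescartes` (stmt-ValiantsHypothesis-18050, V1),
# line «osculation-law» (`Cruxes/MatrixDescartes/Lines/osculation_law.lean`), rung O3 «extremal-support families from the census»:
# the RANK-ONE OSCULATION CERTIFICATE (finiteness + cardinality of the osculation set from two exact checks)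

Roster R2664 (b) / R2685 (O3 = val-sym-engine-7), critic val-idea-crit-1 VERDICT #76 (EDIT 1: finiteness must be PROVED, not
assumed).  This file is the reusable engine; the instances (G6 stamp pencil, both coordinate projectors) are in
`…OsculationCensusExtremisers`.

CONTENT.  `OsculationCensus.osc_rankOne_finite_card_le` (every `s`, every `K`): for a block pencil `G(t) = Σ_l t^{d_l} S_l`
on `Fin 1 ⊕ Fin s` write `F = det G`, `A = det G₂₂` and `R = W(F)·A² − W(A)·F²` (`W(h) = h·θ²h − (θh)²`, `θ = X·d/dX`;
the polynomial of the line's `stub_rankOne`).  If `F` and `A` have NO COMMON POSITIVE ZERO and `R ≢ 0`, then the osculation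
set of the spectral curve `det(G(t) + b·(I₁ ⊕ 0)) = 0` in the open quadrant (the line's `osculationSet d S` with `blockProj`,
`insertionPoly`, `euler`, `logHessian` UNFOLDED verbatim, as in `…OsculationLawStubRankOne`) is FINITE and has at most
`2·(N_F + N_A)` points for any degree bounds `deg F ≤ N_F`, `deg A ≤ N_A`.  Proof: on the curve `A(t) ≠ 0` (else `F(t) = 0`
too — excluded), so `F(t) ≠ 0`, `b = −F(t)/A(t)` and, by the tree identity `OsculationRankOne.hess_identity` (`A²·H = F·R` on
the curve), `R(t) = 0`; hence the set injects into the roots of `R` (finiteness, `Polynomial.mem_roots`), and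
`OsculationRankOne.osc_ncard_le` + `Polynomial.card_roots'` + `θ`-degree bookkeeping give the count.  Plus the `2 × 2`
bookkeeping lemmas `det_pencil_one_one` (`det G = G₁₁G₂₂ − G₁₂G₂₁` on `Fin 1 ⊕ Fin 1`, entries by `OsculationTwoK.pencil_apply`) and `det_lower_one` (`det G₂₂ = G₂₂`).

HONEST FRAMING.  Calibration tooling for a line stub: `m = 2` is covered by the line's rung `rungTwo : OsculationLawAt 2 K
(16·K¹²)`; the LAW `stub_osculationLaw` (Conjecture-B strength), the crux `MatrixDescartes`, Conjecture B and `VP ≠ VNP` are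
OPEN / NOT proved; no summit statement is proved by this file.  No definitions, no named facts; Mathlib + the tree files
`…OsculationLawStubRankOne` (which brings `…OsculationLawRankOneCurve`) and `…OsculationLawTwoKPencil` (`pencil_apply`).
-/

-- `Summit.ValiantsHypothesis.ValiantsHypothesis.…` is the tree's mandated single-conjunct layout (Sub = Summit).
set_option linter.dupNamespace false

noncomputable section

namespace Summit.ValiantsHypothesis.ValiantsHypothesis.Theorems.LacunarySymmetroidMatrixDescartes

open Polynomial Matrix Finset
open scoped BigOperators

namespace OsculationCensus

/-! ### Degree bookkeeping for `θ = X·d/dX` -/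

/-- `θ = X·d/dX` does not raise the degree. [folklore] -/
theorem natDegree_X_mul_derivative_le (p : ℝ[X]) : (X * derivative p).natDegree ≤ p.natDegree := by
  by_cases hp : derivative p = 0
  · simp [hp]
  · have hpos : 0 < p.natDegree := Nat.pos_of_ne_zero fun h => hp (derivative_of_natDegree_zero h)
    calc (X * derivative p).natDegree ≤ (X : ℝ[X]).natDegree + (derivative p).natDegree := natDegree_mul_le
      _ ≤ 1 + (p.natDegree - 1) := Nat.add_le_add natDegree_X_le (natDegree_derivative_le p)
      _ = p.natDegree := by omega

/-- Degree of the rank-one osculation eliminant `R = W(F)·A² − W(A)·F²`: at most `2·(deg F + deg A)`. [folklore] -/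
theorem natDegree_R_le (F A : ℝ[X]) (NF NA : ℕ) (hF : F.natDegree ≤ NF) (hA : A.natDegree ≤ NA) :
    ((F * (X * derivative (X * derivative F)) - (X * derivative F) ^ 2) * A ^ 2
        - (A * (X * derivative (X * derivative A)) - (X * derivative A) ^ 2) * F ^ 2).natDegree ≤ 2 * (NF + NA) := by
  have hθF : (X * derivative F).natDegree ≤ NF := (natDegree_X_mul_derivative_le F).trans hF
  have hθθF : (X * derivative (X * derivative F)).natDegree ≤ NF :=
    (natDegree_X_mul_derivative_le _).trans hθF
  have hθA : (X * derivative A).natDegree ≤ NA := (natDegree_X_mul_derivative_le A).trans hA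
  have hθθA : (X * derivative (X * derivative A)).natDegree ≤ NA :=
    (natDegree_X_mul_derivative_le _).trans hθA
  have hWF : (F * (X * derivative (X * derivative F)) - (X * derivative F) ^ 2).natDegree ≤ 2 * NF := by
    refine (natDegree_sub_le _ _).trans (max_le ?_ ?_)
    · exact natDegree_mul_le.trans (by omega)
    · exact natDegree_pow_le.trans (by omega)
  have hWA : (A * (X * derivative (X * derivative A)) - (X * derivative A) ^ 2).natDegree ≤ 2 * NA := by
    refine (natDegree_sub_le _ _).trans (max_le ?_ ?_)
    · exact natDegree_mul_le.trans (by omega)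
    · exact natDegree_pow_le.trans (by omega)
  have hA2 : (A ^ 2).natDegree ≤ 2 * NA := natDegree_pow_le.trans (by omega)
  have hF2 : (F ^ 2).natDegree ≤ 2 * NF := natDegree_pow_le.trans (by omega)
  refine (natDegree_sub_le _ _).trans (max_le ?_ ?_)
  · exact natDegree_mul_le.trans (by omega)
  · exact natDegree_mul_le.trans (by omega)

/-! ### The rank-one certificate theorem (every `s`) -/

/-- **Rank-one osculation certificate.**  For a block pencil `G(t) = Σ_l t^(d l) S_l` on `Fin 1 ⊕ Fin s`, with `F = det G`,
`A = det G₂₂` and `R = W(F)·A² − W(A)·F²`: if `F` and `A` have no common positive zero and `R ≢ 0`, then the osculation set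
of the spectral curve `det(G(t) + b·(I₁ ⊕ 0)) = 0` in the open quadrant `t > 0, b > 0` (the line's `osculationSet d S` with
`blockProj`, `insertionPoly`, `euler`, `logHessian` UNFOLDED verbatim) is finite and has at most `2·(N_F + N_A)` points for any
degree bounds `deg F ≤ N_F`, `deg A ≤ N_A`. [folklore] -/
theorem osc_rankOne_finite_card_le {s K : ℕ} (d : Fin K → ℕ) (S : Fin K → Matrix (Fin 1 ⊕ Fin s) (Fin 1 ⊕ Fin s) ℝ)
    (F A : ℝ[X]) (hF : (∑ l, (X : ℝ[X]) ^ d l • (S l).map Polynomial.C).det = F)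
    (hA : (∑ l, (X : ℝ[X]) ^ d l • ((S l).toBlocks₂₂).map Polynomial.C).det = A)
    (hcop : ∀ t : ℝ, 0 < t → A.eval t = 0 → F.eval t ≠ 0)
    (hR : (F * (X * derivative (X * derivative F)) - (X * derivative F) ^ 2) * A ^ 2
        - (A * (X * derivative (X * derivative A)) - (X * derivative A) ^ 2) * F ^ 2 ≠ 0)
    (NF NA : ℕ) (hFN : F.natDegree ≤ NF) (hAN : A.natDegree ≤ NA) :
    {p : Fin 2 → ℝ | 0 < p 0 ∧ 0 < p 1 ∧ MvPolynomial.eval p (∑ l, (MvPolynomial.X (0 : Fin 2) : MvPolynomial (Fin 2) ℝ) ^ d l •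
              (S l).map (MvPolynomial.C : ℝ →+* MvPolynomial (Fin 2) ℝ)
            + (MvPolynomial.X (1 : Fin 2) : MvPolynomial (Fin 2) ℝ) •
              (Matrix.fromBlocks 1 0 0 0 : Matrix (Fin 1 ⊕ Fin s) (Fin 1 ⊕ Fin s) ℝ).map
                (MvPolynomial.C : ℝ →+* MvPolynomial (Fin 2) ℝ)).det = 0 ∧
      MvPolynomial.eval p
        (MvPolynomial.X 0 * MvPolynomial.pderiv 0 (MvPolynomial.X 0 * MvPolynomial.pderiv 0 (∑ l, (MvPolynomial.X (0 : Fin 2) : MvPolynomial (Fin 2) ℝ) ^ d l •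
              (S l).map (MvPolynomial.C : ℝ →+* MvPolynomial (Fin 2) ℝ)
            + (MvPolynomial.X (1 : Fin 2) : MvPolynomial (Fin 2) ℝ) •
              (Matrix.fromBlocks 1 0 0 0 : Matrix (Fin 1 ⊕ Fin s) (Fin 1 ⊕ Fin s) ℝ).map
                (MvPolynomial.C : ℝ →+* MvPolynomial (Fin 2) ℝ)).det)
            * (MvPolynomial.X 1 * MvPolynomial.pderiv 1 (∑ l, (MvPolynomial.X (0 : Fin 2) : MvPolynomial (Fin 2) ℝ) ^ d l •
              (S l).map (MvPolynomial.C : ℝ →+* MvPolynomial (Fin 2) ℝ)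
            + (MvPolynomial.X (1 : Fin 2) : MvPolynomial (Fin 2) ℝ) •
              (Matrix.fromBlocks 1 0 0 0 : Matrix (Fin 1 ⊕ Fin s) (Fin 1 ⊕ Fin s) ℝ).map
                (MvPolynomial.C : ℝ →+* MvPolynomial (Fin 2) ℝ)).det) ^ 2
          - 2 * (MvPolynomial.X 0 * MvPolynomial.pderiv 0 (MvPolynomial.X 1 * MvPolynomial.pderiv 1 (∑ l, (MvPolynomial.X (0 : Fin 2) : MvPolynomial (Fin 2) ℝ) ^ d l •
              (S l).map (MvPolynomial.C : ℝ →+* MvPolynomial (Fin 2) ℝ)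
            + (MvPolynomial.X (1 : Fin 2) : MvPolynomial (Fin 2) ℝ) •
              (Matrix.fromBlocks 1 0 0 0 : Matrix (Fin 1 ⊕ Fin s) (Fin 1 ⊕ Fin s) ℝ).map
                (MvPolynomial.C : ℝ →+* MvPolynomial (Fin 2) ℝ)).det))
            * (MvPolynomial.X 0 * MvPolynomial.pderiv 0 (∑ l, (MvPolynomial.X (0 : Fin 2) : MvPolynomial (Fin 2) ℝ) ^ d l •
              (S l).map (MvPolynomial.C : ℝ →+* MvPolynomial (Fin 2) ℝ)
            + (MvPolynomial.X (1 : Fin 2) : MvPolynomial (Fin 2) ℝ) •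
              (Matrix.fromBlocks 1 0 0 0 : Matrix (Fin 1 ⊕ Fin s) (Fin 1 ⊕ Fin s) ℝ).map
                (MvPolynomial.C : ℝ →+* MvPolynomial (Fin 2) ℝ)).det) * (MvPolynomial.X 1 * MvPolynomial.pderiv 1 (∑ l, (MvPolynomial.X (0 : Fin 2) : MvPolynomial (Fin 2) ℝ) ^ d l •
              (S l).map (MvPolynomial.C : ℝ →+* MvPolynomial (Fin 2) ℝ)
            + (MvPolynomial.X (1 : Fin 2) : MvPolynomial (Fin 2) ℝ) •
              (Matrix.fromBlocks 1 0 0 0 : Matrix (Fin 1 ⊕ Fin s) (Fin 1 ⊕ Fin s) ℝ).map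
                (MvPolynomial.C : ℝ →+* MvPolynomial (Fin 2) ℝ)).det)
          + MvPolynomial.X 1 * MvPolynomial.pderiv 1 (MvPolynomial.X 1 * MvPolynomial.pderiv 1 (∑ l, (MvPolynomial.X (0 : Fin 2) : MvPolynomial (Fin 2) ℝ) ^ d l •
              (S l).map (MvPolynomial.C : ℝ →+* MvPolynomial (Fin 2) ℝ)
            + (MvPolynomial.X (1 : Fin 2) : MvPolynomial (Fin 2) ℝ) •
              (Matrix.fromBlocks 1 0 0 0 : Matrix (Fin 1 ⊕ Fin s) (Fin 1 ⊕ Fin s) ℝ).map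
                (MvPolynomial.C : ℝ →+* MvPolynomial (Fin 2) ℝ)).det)
            * (MvPolynomial.X 0 * MvPolynomial.pderiv 0 (∑ l, (MvPolynomial.X (0 : Fin 2) : MvPolynomial (Fin 2) ℝ) ^ d l •
              (S l).map (MvPolynomial.C : ℝ →+* MvPolynomial (Fin 2) ℝ)
            + (MvPolynomial.X (1 : Fin 2) : MvPolynomial (Fin 2) ℝ) •
              (Matrix.fromBlocks 1 0 0 0 : Matrix (Fin 1 ⊕ Fin s) (Fin 1 ⊕ Fin s) ℝ).map
                (MvPolynomial.C : ℝ →+* MvPolynomial (Fin 2) ℝ)).det) ^ 2) = 0}.Finite ∧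
    {p : Fin 2 → ℝ | 0 < p 0 ∧ 0 < p 1 ∧ MvPolynomial.eval p (∑ l, (MvPolynomial.X (0 : Fin 2) : MvPolynomial (Fin 2) ℝ) ^ d l •
              (S l).map (MvPolynomial.C : ℝ →+* MvPolynomial (Fin 2) ℝ)
            + (MvPolynomial.X (1 : Fin 2) : MvPolynomial (Fin 2) ℝ) •
              (Matrix.fromBlocks 1 0 0 0 : Matrix (Fin 1 ⊕ Fin s) (Fin 1 ⊕ Fin s) ℝ).map
                (MvPolynomial.C : ℝ →+* MvPolynomial (Fin 2) ℝ)).det = 0 ∧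
      MvPolynomial.eval p
        (MvPolynomial.X 0 * MvPolynomial.pderiv 0 (MvPolynomial.X 0 * MvPolynomial.pderiv 0 (∑ l, (MvPolynomial.X (0 : Fin 2) : MvPolynomial (Fin 2) ℝ) ^ d l •
              (S l).map (MvPolynomial.C : ℝ →+* MvPolynomial (Fin 2) ℝ)
            + (MvPolynomial.X (1 : Fin 2) : MvPolynomial (Fin 2) ℝ) •
              (Matrix.fromBlocks 1 0 0 0 : Matrix (Fin 1 ⊕ Fin s) (Fin 1 ⊕ Fin s) ℝ).map
                (MvPolynomial.C : ℝ →+* MvPolynomial (Fin 2) ℝ)).det)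
            * (MvPolynomial.X 1 * MvPolynomial.pderiv 1 (∑ l, (MvPolynomial.X (0 : Fin 2) : MvPolynomial (Fin 2) ℝ) ^ d l •
              (S l).map (MvPolynomial.C : ℝ →+* MvPolynomial (Fin 2) ℝ)
            + (MvPolynomial.X (1 : Fin 2) : MvPolynomial (Fin 2) ℝ) •
              (Matrix.fromBlocks 1 0 0 0 : Matrix (Fin 1 ⊕ Fin s) (Fin 1 ⊕ Fin s) ℝ).map
                (MvPolynomial.C : ℝ →+* MvPolynomial (Fin 2) ℝ)).det) ^ 2
          - 2 * (MvPolynomial.X 0 * MvPolynomial.pderiv 0 (MvPolynomial.X 1 * MvPolynomial.pderiv 1 (∑ l, (MvPolynomial.X (0 : Fin 2) : MvPolynomial (Fin 2) ℝ) ^ d l •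
              (S l).map (MvPolynomial.C : ℝ →+* MvPolynomial (Fin 2) ℝ)
            + (MvPolynomial.X (1 : Fin 2) : MvPolynomial (Fin 2) ℝ) •
              (Matrix.fromBlocks 1 0 0 0 : Matrix (Fin 1 ⊕ Fin s) (Fin 1 ⊕ Fin s) ℝ).map
                (MvPolynomial.C : ℝ →+* MvPolynomial (Fin 2) ℝ)).det))
            * (MvPolynomial.X 0 * MvPolynomial.pderiv 0 (∑ l, (MvPolynomial.X (0 : Fin 2) : MvPolynomial (Fin 2) ℝ) ^ d l •
              (S l).map (MvPolynomial.C : ℝ →+* MvPolynomial (Fin 2) ℝ)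
            + (MvPolynomial.X (1 : Fin 2) : MvPolynomial (Fin 2) ℝ) •
              (Matrix.fromBlocks 1 0 0 0 : Matrix (Fin 1 ⊕ Fin s) (Fin 1 ⊕ Fin s) ℝ).map
                (MvPolynomial.C : ℝ →+* MvPolynomial (Fin 2) ℝ)).det) * (MvPolynomial.X 1 * MvPolynomial.pderiv 1 (∑ l, (MvPolynomial.X (0 : Fin 2) : MvPolynomial (Fin 2) ℝ) ^ d l •
              (S l).map (MvPolynomial.C : ℝ →+* MvPolynomial (Fin 2) ℝ)
            + (MvPolynomial.X (1 : Fin 2) : MvPolynomial (Fin 2) ℝ) •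
              (Matrix.fromBlocks 1 0 0 0 : Matrix (Fin 1 ⊕ Fin s) (Fin 1 ⊕ Fin s) ℝ).map
                (MvPolynomial.C : ℝ →+* MvPolynomial (Fin 2) ℝ)).det)
          + MvPolynomial.X 1 * MvPolynomial.pderiv 1 (MvPolynomial.X 1 * MvPolynomial.pderiv 1 (∑ l, (MvPolynomial.X (0 : Fin 2) : MvPolynomial (Fin 2) ℝ) ^ d l •
              (S l).map (MvPolynomial.C : ℝ →+* MvPolynomial (Fin 2) ℝ)
            + (MvPolynomial.X (1 : Fin 2) : MvPolynomial (Fin 2) ℝ) •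
              (Matrix.fromBlocks 1 0 0 0 : Matrix (Fin 1 ⊕ Fin s) (Fin 1 ⊕ Fin s) ℝ).map
                (MvPolynomial.C : ℝ →+* MvPolynomial (Fin 2) ℝ)).det)
            * (MvPolynomial.X 0 * MvPolynomial.pderiv 0 (∑ l, (MvPolynomial.X (0 : Fin 2) : MvPolynomial (Fin 2) ℝ) ^ d l •
              (S l).map (MvPolynomial.C : ℝ →+* MvPolynomial (Fin 2) ℝ)
            + (MvPolynomial.X (1 : Fin 2) : MvPolynomial (Fin 2) ℝ) •
              (Matrix.fromBlocks 1 0 0 0 : Matrix (Fin 1 ⊕ Fin s) (Fin 1 ⊕ Fin s) ℝ).map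
                (MvPolynomial.C : ℝ →+* MvPolynomial (Fin 2) ℝ)).det) ^ 2) = 0}.ncard ≤ 2 * (NF + NA) := by
  classical
  -- the insertion polynomial at rank one: `Φ = ι F + X₁ · ι A`
  have hΦ := OsculationRankOne.insertionPoly_eq d S
  rw [hF, hA] at hΦ
  rw [hΦ]
  set Φ : MvPolynomial (Fin 2) ℝ := Polynomial.aeval (MvPolynomial.X 0 : MvPolynomial (Fin 2) ℝ) F
      + MvPolynomial.X 1 * Polynomial.aeval (MvPolynomial.X 0 : MvPolynomial (Fin 2) ℝ) A with hΦdef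
  set R : ℝ[X] := (F * (X * derivative (X * derivative F)) - (X * derivative F) ^ 2) * A ^ 2
      - (A * (X * derivative (X * derivative A)) - (X * derivative A) ^ 2) * F ^ 2 with hRdef
  set osc := {p : Fin 2 → ℝ | 0 < p 0 ∧ 0 < p 1 ∧ MvPolynomial.eval p Φ = 0 ∧
      MvPolynomial.eval p
        (MvPolynomial.X 0 * MvPolynomial.pderiv 0 (MvPolynomial.X 0 * MvPolynomial.pderiv 0 Φ)
            * (MvPolynomial.X 1 * MvPolynomial.pderiv 1 Φ) ^ 2
          - 2 * (MvPolynomial.X 0 * MvPolynomial.pderiv 0 (MvPolynomial.X 1 * MvPolynomial.pderiv 1 Φ))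
            * (MvPolynomial.X 0 * MvPolynomial.pderiv 0 Φ) * (MvPolynomial.X 1 * MvPolynomial.pderiv 1 Φ)
          + MvPolynomial.X 1 * MvPolynomial.pderiv 1 (MvPolynomial.X 1 * MvPolynomial.pderiv 1 Φ)
            * (MvPolynomial.X 0 * MvPolynomial.pderiv 0 Φ) ^ 2) = 0} with hosc
  -- membership, unfolded to real numbers (tree lemmas `eval_logHessian_Phi`, `eval_Phi`)
  have mem_osc : ∀ p : Fin 2 → ℝ, p ∈ osc ↔ 0 < p 0 ∧ 0 < p 1 ∧ F.eval (p 0) + p 1 * A.eval (p 0) = 0 ∧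
      p 0 * ((derivative F).eval (p 0) + p 1 * (derivative A).eval (p 0)
              + p 0 * ((derivative (derivative F)).eval (p 0)
                  + p 1 * (derivative (derivative A)).eval (p 0)))
          * (p 1 * A.eval (p 0)) ^ 2
        - 2 * (p 0 * (p 1 * (derivative A).eval (p 0)))
          * (p 0 * ((derivative F).eval (p 0) + p 1 * (derivative A).eval (p 0))) * (p 1 * A.eval (p 0))
        + p 1 * A.eval (p 0) * (p 0 * ((derivative F).eval (p 0) + p 1 * (derivative A).eval (p 0))) ^ 2
          = 0 := by
    intro p
    rw [hosc, Set.mem_setOf_eq, OsculationRankOne.eval_logHessian_Phi F A Φ hΦdef p, hΦdef, OsculationRankOne.eval_Phi]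
  -- (1) finiteness: the set injects into the roots of `R ≢ 0`
  have hfin : osc.Finite := by
    refine ((R.roots.toFinset.finite_toSet).image
      (fun t : ℝ => (![t, -F.eval t / A.eval t] : Fin 2 → ℝ))).subset fun p hp => ?_
    obtain ⟨ht, hb, hcurve, hH⟩ := (mem_osc p).1 hp
    have hAp : A.eval (p 0) ≠ 0 := by
      intro hA0
      have hF0 : F.eval (p 0) = 0 := by rw [hA0, mul_zero, add_zero] at hcurve; exact hcurve
      exact hcop (p 0) ht hA0 hF0
    have hFp : F.eval (p 0) ≠ 0 := by
      intro hF0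
      rw [hF0, zero_add] at hcurve
      exact mul_ne_zero hb.ne' hAp hcurve
    have key := OsculationRankOne.hess_identity F A (p 0) (p 1) hcurve
    rw [hH, mul_zero] at key
    have hRroot : R.eval (p 0) = 0 := by
      rcases mul_eq_zero.1 key.symm with h | h
      · exact absurd h hFp
      · rw [hRdef]; exact h
    have hp1 : p 1 = -F.eval (p 0) / A.eval (p 0) := by
      rw [eq_div_iff hAp]; linarith
    refine ⟨p 0, ?_, ?_⟩
    · rw [Finset.mem_coe, Multiset.mem_toFinset, mem_roots hR]
      exact hRroot
    · funext i
      fin_cases i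
      · rfl
      · simp only [Fin.mk_one, Matrix.cons_val_one]
        exact hp1.symm
  refine ⟨hfin, ?_⟩
  -- (2) the count: `#osc ≤ Z₊mult(R) ≤ #roots(R) ≤ deg R ≤ 2 (N_F + N_A)`
  calc osc.ncard ≤ Multiset.card (R.roots.filter (fun t => 0 < t)) :=
        OsculationRankOne.osc_ncard_le F A Φ hΦdef hfin
    _ ≤ Multiset.card R.roots := Multiset.card_le_card (Multiset.filter_le _ _)
    _ ≤ R.natDegree := card_roots' R
    _ ≤ 2 * (NF + NA) := natDegree_R_le F A NF NA hFN hAN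


/-! ### `2 × 2` bookkeeping (`s = 1`): the determinant and the lower block of a `Fin 1 ⊕ Fin 1` pencil -/

/-- `det G = G₁₁ G₂₂ − G₁₂ G₂₁` for a `Fin 1 ⊕ Fin 1` pencil. [folklore] -/
theorem det_pencil_one_one {K : ℕ} (d : Fin K → ℕ) (S : Fin K → Matrix (Fin 1 ⊕ Fin 1) (Fin 1 ⊕ Fin 1) ℝ) :
    (∑ l, (X : ℝ[X]) ^ d l • (S l).map Polynomial.C).det =
      (∑ l, Polynomial.C (S l (Sum.inl 0) (Sum.inl 0)) * X ^ d l) *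
          (∑ l, Polynomial.C (S l (Sum.inr 0) (Sum.inr 0)) * X ^ d l)
        - (∑ l, Polynomial.C (S l (Sum.inl 0) (Sum.inr 0)) * X ^ d l) *
          (∑ l, Polynomial.C (S l (Sum.inr 0) (Sum.inl 0)) * X ^ d l) := by
  rw [← Matrix.det_reindex_self finSumFinEquiv, Matrix.det_fin_two]
  simp only [Matrix.reindex_apply, Matrix.submatrix_apply, OsculationTwoK.pencil_apply]
  have e0 : (finSumFinEquiv.symm (0 : Fin (1 + 1)) : Fin 1 ⊕ Fin 1) = Sum.inl 0 := by decide
  have e1 : (finSumFinEquiv.symm (1 : Fin (1 + 1)) : Fin 1 ⊕ Fin 1) = Sum.inr 0 := by decide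
  rw [e0, e1]

/-- `det G₂₂ = G₂₂` for a `Fin 1 ⊕ Fin 1` pencil. [folklore] -/
theorem det_lower_one {K : ℕ} (d : Fin K → ℕ) (S : Fin K → Matrix (Fin 1 ⊕ Fin 1) (Fin 1 ⊕ Fin 1) ℝ) :
    (∑ l, (X : ℝ[X]) ^ d l • ((S l).toBlocks₂₂).map Polynomial.C).det =
      ∑ l, Polynomial.C (S l (Sum.inr 0) (Sum.inr 0)) * X ^ d l := by
  rw [Matrix.det_unique]
  simp only [Matrix.sum_apply, Matrix.smul_apply, Matrix.map_apply, smul_eq_mul, Matrix.toBlocks₂₂, Matrix.of_apply]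
  exact Finset.sum_congr rfl fun l _ => mul_comm _ _

end OsculationCensus

end Summit.ValiantsHypothesis.ValiantsHypothesis.Theorems.LacunarySymmetroidMatrixDescartes
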